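import Summits.HodgeConjecture.HodgeConjecture.Theorems.HLiu418E2ArchOrthHolPrep
import Literature.Analysis.Complex.HolomorphicParametricIntegral
import Mathlib.Analysis.Complex.MeanValue
import HarnessLib

/-!
# Crux `HLiu418`, K-lane E₂ — S2⁺₂ `ArchOrthHolType₂` by the DISC IDENTITY: archimedean orthogonality for a pair of cone-holomorphic
# cotangent forms of a rank-2 unitary group, from a rotation-invariant holomorphic function on the slice disc

Cell `hodgecm-mathlib`, FLOOR 0, programme P5 (`F0_AlbCm`); crux item `stmt-HodgeConjecture-24832`; seat F0P5-p02 (g2),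
`--supports stmt-HodgeConjecture-24832` (helper).  THEOREMS ONLY — no definition, no instance, no notation, no `sorry`.

THE ARGUMENT (generic rank-2 unitary datum `U(J)`, complex place `w₁`, cone frame `𝔣` with `⟪v₀,t₀⟫ = 0`, `⟪v₀,v₀⟫ = −r⟪t₀,t₀⟫`, compact
automorphic quotient).  Let `f, f₃ ∈ holCotForms₂ … 𝔣` with classes `F = [f]`, `F₃ = [f₃] ∈ L²` and `⟪F, F₃⟫ = 0`.  For `|z|² < r` put
`Φ(z) := ν_z⁻² ⟪F₃, R(ι u_z) F⟫` with the boost `u_z` of ★ `E2DiscBoost.exists_boost` (`ν_z² = (r − |z|²)/r`).  Then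
(1) `Φ(z) = ∫ conj(φ₃) · E_x(s(z)) dμ` where `E_x` is the cone-holomorphic extension of the slice of `f` at `x` and `s(z) = 1 + zN` the holomorphic
slice (★ `E2ArchOrthHolPrep.apply_slice_eq`), so `Φ` is HOLOMORPHIC on the disc `|z| < √r` (★ `Literature.Analysis.Complex.differentiableOn_integral_of_dominated`:
each `z ↦ E_x(s(z))` is holomorphic, the integrand is continuous in `x` and bounded by `‖f₃‖_∞ ‖f‖_∞ r/(r − |z|²)` on the compact quotient);
(2) `Φ(wz) = Φ(z)` for `|w| = 1`: `u_{wz} = k_w u_z k_w⁻¹` (★ `rotation_mul_boost_mul_inv`) and the rotations act on `F`, `F₃` by the unimodular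
cotangent character `w` (★ `rightRegular_rotation`), `R` being unitary; (3) `Φ(0) = ⟪F₃, F⟫ = conj ⟪F, F₃⟫ = 0`; (4) the mean value property
(Mathlib `DiffContOnCl.circleAverage`) on each circle `|z| = t`, where `Φ` is constant by (2), gives `Φ(t) = Φ(0) = 0`, whence `Φ ≡ 0`; (5) every
`u ∈ U` is `u_z κ` with `κ ∈ Stab(ℂ v₀)` (★ `exists_coords_of_archLocal`), so `R(ι u) F = λ(κ) • R(ι u_z) F` (★ `rightRegular_adelicSingle_mul`)
and `⟪R(ι u) F, F₃⟫ = conj(λ(κ)) · ν_z² · conj Φ(z) = 0`.  Head: **`archOrth₂_of_frame`**; the CM specialisation in the binder prefix of the letter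
`UnitaryCurveForms.cohIsotypicLine₂_hol` (= the body of the cut `ArchOrthHolType₂`) is ★-candidate `Theorems/HLiu418E2ArchOrthHolCM`.
No Lie algebra, no `(𝔤,K)`-modules, no Nelson analyticity and no Harish-Chandra closure are used (contrast the rank-3 ★ `F0P2aArchOrthHol`).
HONEST LABEL: HC_CM is proved only modulo the 7 printed citations until rung 0 closes; this file discharges none of them.

## References
* [Borel1997] A. Borel, *Automorphic forms on SL₂(ℝ)* (1997), §5.13–§5.14.  [BorelJacquet1979] Corvallis PSPM 33.1, §4.6.
* [BorelWallach2000] VII 3.2.  [Liu2021] App. D Lem. D.2 (2).  [AhlforsCA1979] L. Ahlfors, *Complex Analysis*, Ch. 4 §3.4 (mean value).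
-/

set_option autoImplicit false
-- the mandated namespace has the single-problem summit's repeated segment (`HodgeConjecture.HodgeConjecture`)
set_option linter.dupNamespace false

noncomputable section

open Matrix MeasureTheory NumberField NumberField.InfinitePlace Metric
open scoped Matrix ComplexConjugate ComplexOrder InnerProductSpace ENNReal
open Literature.NumberTheory.Automorphic Literature.NumberTheory.Automorphic.UnitaryGroup
open Literature.NumberTheory.Automorphic.UnitaryGroup.CotangentForms (toQuotFun toQuotFun_mk)
open Literature.NumberTheory.Automorphic.UnitaryCurveForms
open Literature.AlgebraicGeometry.ShimuraVarieties Literature.AlgebraicGeometry.ShimuraVarieties.UnitaryCurveCone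
open Summit.HodgeConjecture.HodgeConjecture.Cruxes.H413.SpectrumJunction
open Summit.HodgeConjecture.HodgeConjecture.Cruxes.HLiu418.E2Density
open Summit.HodgeConjecture.HodgeConjecture.Cruxes.HLiu418.E2Bootstrap
open Summit.HodgeConjecture.HodgeConjecture.Cruxes.HLiu418.E2DiscSlice
open Summit.HodgeConjecture.HodgeConjecture.Cruxes.HLiu418.E2DiscBoost
open Summit.HodgeConjecture.HodgeConjecture.Cruxes.HLiu418.E2ArchOrthHolPrep

namespace Summit.HodgeConjecture.HodgeConjecture.Cruxes.HLiu418.E2ArchOrthHol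

variable {F E : Type} [Field F] [NumberField F] [Field E] [NumberField E] [Algebra F E]
  {c : E ≃ₐ[F] E} {J : Matrix (Fin 2) (Fin 2) E}
  {hc : c ≠ 1} {hfix : ∀ w : InfinitePlace E, c • w = w} {w₁ : {w : InfinitePlace E // IsComplex w}} {𝔣 : ConeFrame E J w₁}
  {μ : Measure (adelicGroupData F E c 2 J).automorphicQuotient} [(adelicGroupData F E c 2 J).IsAutomorphicMeasure μ]
  [CompactSpace (adelicGroupData F E c 2 J).automorphicQuotient]

/-! ## §1 Elementary facts on the slice disc `|z|² < r` -/

/-- `|z|² < r ↔ |z| < √r`. [cite: AhlforsCA1979, Ch. 4 §3.4] -/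
theorem norm_sq_lt_iff {r : ℝ} (z : ℂ) : ‖z‖ ^ 2 < r ↔ z ∈ ball (0 : ℂ) (Real.sqrt r) := by
  rw [mem_ball, dist_zero_right, Real.lt_sqrt (norm_nonneg z)]

/-- The boost parameter `ν_z = √((r − |z|²)/r)` is positive with `ν_z² r = r − |z|²` on the disc. [cite: Borel1997, §5.13–§5.14] -/
theorem boostParam_pos_and_sq {r : ℝ} (hr : 0 < r) {z : ℂ} (hz : ‖z‖ ^ 2 < r) :
    0 < Real.sqrt ((r - ‖z‖ ^ 2) / r) ∧ (Real.sqrt ((r - ‖z‖ ^ 2) / r)) ^ 2 * r = r - ‖z‖ ^ 2 := by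
  have hpos : 0 < (r - ‖z‖ ^ 2) / r := div_pos (sub_pos.2 hz) hr
  refine ⟨Real.sqrt_pos.2 hpos, ?_⟩
  rw [Real.sq_sqrt hpos.le, div_mul_cancel₀ _ hr.ne']

/-- `ν_z⁻¹ ν_z⁻¹ = r/(r − |z|²)` as a complex number, and its norm. [cite: Borel1997, §5.13–§5.14] -/
theorem boostMultiplier_eq {r : ℝ} (hr : 0 < r) {z : ℂ} (hz : ‖z‖ ^ 2 < r) :
    ((Real.sqrt ((r - ‖z‖ ^ 2) / r) : ℂ))⁻¹ * ((Real.sqrt ((r - ‖z‖ ^ 2) / r) : ℂ))⁻¹ = ((r / (r - ‖z‖ ^ 2) : ℝ) : ℂ) := by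
  obtain ⟨hν, hν2⟩ := boostParam_pos_and_sq hr hz
  have hsub : r - ‖z‖ ^ 2 ≠ 0 := (sub_pos.2 hz).ne'
  rw [← mul_inv, ← Complex.ofReal_mul, ← Complex.ofReal_inv, ← pow_two]
  congr 1
  rw [Real.sq_sqrt (div_pos (sub_pos.2 hz) hr).le, inv_div]

/-! ## §2 The head: archimedean orthogonality by the disc identity -/

/-- **S2⁺₂ (generic frame form) — archimedean orthogonality for a pair of cone-holomorphic cotangent forms.**  For a rank-2 unitary datum
`U(J)`, a complex place `w₁`, a cone frame `𝔣` with `⟪v₀, t₀⟫ = 0` and `⟪v₀,v₀⟫ = −r ⟪t₀,t₀⟫` (`r > 0`), a compact automorphic quotient with an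
automorphic measure `μ`, and `f, f₃ ∈ holCotForms₂ … 𝔣` with `⟪[f], [f₃]⟫_{L²} = 0`: `⟪R(ι u)[f], [f₃]⟫_{L²} = 0` for EVERY `u ∈ U(σ_{w₁}J)(ℂ)`
(`ι = adelicSingle w₁`).  Proof: the module docstring, steps (1)–(5). [cite: BorelWallach2000, VII 3.2] [cite: Liu2021, App. D Lem. D.2 (2)]
[cite: AhlforsCA1979, Ch. 4 §3.4] -/
theorem archOrth₂_of_frame (hvt : star 𝔣.v₀ ⬝ᵥ (J.map w₁.1.embedding *ᵥ 𝔣.t₀) = 0) {r : ℝ} (hr : 0 < r)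
    (hvv : star 𝔣.v₀ ⬝ᵥ (J.map w₁.1.embedding *ᵥ 𝔣.v₀) = -(r : ℂ) * (star 𝔣.t₀ ⬝ᵥ (J.map w₁.1.embedding *ᵥ 𝔣.t₀)))
    {f f₃ : (adelicGroupData F E c 2 J).Adelic → ℂ} (hf : f ∈ holCotForms₂ F E c J hc hfix w₁ 𝔣) (hf₃ : f₃ ∈ holCotForms₂ F E c J hc hfix w₁ 𝔣)
    (hfm : MemLp (toQuotFun (adelicGroupData F E c 2 J) f) 2 μ) (h₃m : MemLp (toQuotFun (adelicGroupData F E c 2 J) f₃) 2 μ)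
    (h0 : ⟪hfm.toLp (toQuotFun (adelicGroupData F E c 2 J) f), h₃m.toLp (toQuotFun (adelicGroupData F E c 2 J) f₃)⟫_ℂ = 0)
    (u : archLocal E 2 J w₁) :
    ⟪(adelicGroupData F E c 2 J).rightRegular μ (adelicSingle F E c 2 J hc hfix w₁ u) (hfm.toLp (toQuotFun (adelicGroupData F E c 2 J) f)),
      h₃m.toLp (toQuotFun (adelicGroupData F E c 2 J) f₃)⟫_ℂ = 0 := by
  classical
  -- left invariance and continuity of the two forms
  have hfL := leftInvariant_of_mem_holCotForms₂ hf
  have hf₃L := leftInvariant_of_mem_holCotForms₂ hf₃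
  have hfC := continuous_of_mem_holCotForms₂ F E c J hc hfix w₁ 𝔣 hf
  have hf₃C := continuous_of_mem_holCotForms₂ F E c J hc hfix w₁ 𝔣 hf₃
  -- the boost parameter `ν_z` and the boosts `u_z`
  let ν : ℂ → ℝ := fun z => Real.sqrt ((r - ‖z‖ ^ 2) / r)
  have hν : ∀ z : ℂ, ‖z‖ ^ 2 < r → 0 < ν z ∧ (ν z) ^ 2 * r = r - ‖z‖ ^ 2 := fun z hz => boostParam_pos_and_sq hr hz
  have hB : ∀ z : ℂ, ‖z‖ ^ 2 < r → ∃ u : archLocal E 2 J w₁,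
      ((u : GL (Fin 2) ℂ) : Matrix (Fin 2) (Fin 2) ℂ) *ᵥ 𝔣.t₀ = (ν z : ℂ)⁻¹ • 𝔣.t₀ + ((ν z : ℂ)⁻¹ * (starRingEnd ℂ z / r)) • 𝔣.v₀ ∧
      ((u : GL (Fin 2) ℂ) : Matrix (Fin 2) (Fin 2) ℂ) *ᵥ 𝔣.v₀ = ((ν z : ℂ)⁻¹ * z) • 𝔣.t₀ + (ν z : ℂ)⁻¹ • 𝔣.v₀ ∧
      (((u⁻¹ : archLocal E 2 J w₁) : GL (Fin 2) ℂ) : Matrix (Fin 2) (Fin 2) ℂ) *ᵥ 𝔣.t₀ =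
        (ν z : ℂ)⁻¹ • 𝔣.t₀ + (-((ν z : ℂ)⁻¹ * (starRingEnd ℂ z / r))) • 𝔣.v₀ ∧
      (((u⁻¹ : archLocal E 2 J w₁) : GL (Fin 2) ℂ) : Matrix (Fin 2) (Fin 2) ℂ) *ᵥ 𝔣.v₀ = (-((ν z : ℂ)⁻¹ * z)) • 𝔣.t₀ + (ν z : ℂ)⁻¹ • 𝔣.v₀ :=
    fun z hz => exists_boost 𝔣 hvt hr hvv (hν z hz).1 (hν z hz).2
  let ub : ℂ → archLocal E 2 J w₁ := fun z => if hz : ‖z‖ ^ 2 < r then (hB z hz).choose else 1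
  have hub : ∀ (z : ℂ) (hz : ‖z‖ ^ 2 < r),
      ((ub z : GL (Fin 2) ℂ) : Matrix (Fin 2) (Fin 2) ℂ) *ᵥ 𝔣.t₀ = (ν z : ℂ)⁻¹ • 𝔣.t₀ + ((ν z : ℂ)⁻¹ * (starRingEnd ℂ z / r)) • 𝔣.v₀ ∧
      ((ub z : GL (Fin 2) ℂ) : Matrix (Fin 2) (Fin 2) ℂ) *ᵥ 𝔣.v₀ = ((ν z : ℂ)⁻¹ * z) • 𝔣.t₀ + (ν z : ℂ)⁻¹ • 𝔣.v₀ ∧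
      ((((ub z)⁻¹ : archLocal E 2 J w₁) : GL (Fin 2) ℂ) : Matrix (Fin 2) (Fin 2) ℂ) *ᵥ 𝔣.t₀ =
        (ν z : ℂ)⁻¹ • 𝔣.t₀ + (-((ν z : ℂ)⁻¹ * (starRingEnd ℂ z / r))) • 𝔣.v₀ ∧
      ((((ub z)⁻¹ : archLocal E 2 J w₁) : GL (Fin 2) ℂ) : Matrix (Fin 2) (Fin 2) ℂ) *ᵥ 𝔣.v₀ =
        (-((ν z : ℂ)⁻¹ * z)) • 𝔣.t₀ + (ν z : ℂ)⁻¹ • 𝔣.v₀ := by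
    intro z hz
    have h : ub z = (hB z hz).choose := dif_pos hz
    rw [h]
    exact (hB z hz).choose_spec
  -- the function `Φ`
  let Φ : ℂ → ℂ := fun z => ((ν z : ℂ)⁻¹ * (ν z : ℂ)⁻¹) *
    ⟪(h₃m.toLp (toQuotFun (adelicGroupData F E c 2 J) f₃)), (adelicGroupData F E c 2 J).rightRegular μ (adelicSingle F E c 2 J hc hfix w₁ (ub z)) (hfm.toLp (toQuotFun (adelicGroupData F E c 2 J) f))⟫_ℂ
  have hΦdef : ∀ z, Φ z = ((ν z : ℂ)⁻¹ * (ν z : ℂ)⁻¹) *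
    ⟪(h₃m.toLp (toQuotFun (adelicGroupData F E c 2 J) f₃)), (adelicGroupData F E c 2 J).rightRegular μ (adelicSingle F E c 2 J hc hfix w₁ (ub z)) (hfm.toLp (toQuotFun (adelicGroupData F E c 2 J) f))⟫_ℂ := fun _ => rfl
  /- (2) rotation invariance -/
  have hrot : ∀ z : ℂ, ‖z‖ ^ 2 < r → ∀ w : ℂ, ‖w‖ = 1 → Φ (w * z) = Φ z := by
    intro z hz w hw
    have hwz : ‖w * z‖ ^ 2 < r := by rwa [norm_mul, hw, one_mul]
    have hνw : ν (w * z) = ν z := by simp only [ν, norm_mul, hw, one_mul]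
    have hw0 : w ≠ 0 := fun h0 => by rw [h0, norm_zero] at hw; exact zero_ne_one hw
    obtain ⟨k, hkt, hkv⟩ := exists_rotation 𝔣 hvt w hw
    obtain ⟨hut, huv, -, -⟩ := hub z hz
    obtain ⟨hu't, hu'v, -, -⟩ := hub (w * z) hwz
    rw [hνw] at hu't hu'v
    have hconj : k * ub z * k⁻¹ = ub (w * z) := rotation_mul_boost_mul_inv 𝔣 hvt hw hkt hkv hut huv hu't hu'v
    rw [hΦdef, hΦdef, hνw, ← hconj, map_mul, map_mul, map_mul, map_mul, mul_apply_eq_comp, mul_apply_eq_comp,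
      rightRegular_rotation_inv hf hfm hw hkt hkv, map_smul, map_smul, inner_smul_right, inner_rightRegular_right, ← map_inv,
      rightRegular_rotation_inv hf₃ h₃m hw hkt hkv, inner_smul_left]
    have hww : starRingEnd ℂ w⁻¹ * w⁻¹ = 1 := by rw [Complex.conj_mul', norm_inv, hw, inv_one]; norm_num
    linear_combination (((ν z : ℂ))⁻¹ * ((ν z : ℂ))⁻¹ *
      ⟪(h₃m.toLp (toQuotFun (adelicGroupData F E c 2 J) f₃)), (adelicGroupData F E c 2 J).rightRegular μ (adelicSingle F E c 2 J hc hfix w₁ (ub z)) (hfm.toLp (toQuotFun (adelicGroupData F E c 2 J) f))⟫_ℂ) * hww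
  /- (3) the value at `0` -/
  have hz0 : ‖(0 : ℂ)‖ ^ 2 < r := by rw [norm_zero]; simpa using hr
  have hν0 : ν 0 = 1 := by simp only [ν, norm_zero]; rw [zero_pow two_ne_zero, sub_zero, div_self hr.ne', Real.sqrt_one]
  have hub0 : ub 0 = 1 := by
    obtain ⟨hut, huv, -, -⟩ := hub 0 hz0
    rw [hν0] at hut huv
    simp only [Complex.ofReal_one, inv_one, map_zero, zero_div, mul_zero, zero_smul, add_zero, zero_add, one_smul] at hut huv
    apply Subtype.ext
    apply Units.ext
    change ((ub 0 : GL (Fin 2) ℂ) : Matrix (Fin 2) (Fin 2) ℂ) = 1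
    exact matrix_eq_of_frame 𝔣 hvt (by rw [hut, one_mulVec]) (by rw [huv, one_mulVec])
  have hΦ0 : Φ 0 = 0 := by
    rw [hΦdef, hub0, map_one, map_one, one_apply_eq_self, hν0, ← inner_conj_symm, h0, map_zero, mul_zero]
  /- (1) holomorphy on the disc -/
  -- bounds for the two forms
  have hφ₃C : Continuous (toQuotFun (adelicGroupData F E c 2 J) f₃) := continuous_toQuotFun hf₃L hf₃C
  obtain ⟨C₃, hC₃⟩ := (isCompact_univ (X := (adelicGroupData F E c 2 J).automorphicQuotient)).exists_bound_of_continuousOn hφ₃C.continuousOn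
  obtain ⟨Cf, hCf⟩ := (isCompact_univ (X := (adelicGroupData F E c 2 J).automorphicQuotient)).exists_bound_of_continuousOn
    (continuous_toQuotFun hfL hfC).continuousOn
  have hfb : ∀ y, ‖f y‖ ≤ Cf := fun y => by rw [apply_eq_toQuotFun hfL y]; exact hCf _ (Set.mem_univ _)
  have hC₃0 : 0 ≤ C₃ := le_trans (norm_nonneg _) (hC₃ ((adelicGroupData F E c 2 J).toAutomorphicQuotient 1) (Set.mem_univ _))
  have hCf0 : 0 ≤ Cf := le_trans (norm_nonneg _) (hfb 1)
  -- the nilpotent of the slice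
  obtain ⟨N, hNv, hNt, hNN⟩ := exists_nilpotent 𝔣 hvt
  -- the integrand
  let K : ℂ → (adelicGroupData F E c 2 J).automorphicQuotient → ℂ := fun z ξ => ((ν z : ℂ)⁻¹ * (ν z : ℂ)⁻¹) *
    (starRingEnd ℂ (toQuotFun (adelicGroupData F E c 2 J) f₃ ξ) *
      toQuotFun (adelicGroupData F E c 2 J) (fun x => f (x * adelicSingle F E c 2 J hc hfix w₁ (ub z))) ξ)
  have hKdef : ∀ z ξ, K z ξ = ((ν z : ℂ)⁻¹ * (ν z : ℂ)⁻¹) *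
    (starRingEnd ℂ (toQuotFun (adelicGroupData F E c 2 J) f₃ ξ) *
      toQuotFun (adelicGroupData F E c 2 J) (fun x => f (x * adelicSingle F E c 2 J hc hfix w₁ (ub z))) ξ) := fun _ _ => rfl
  -- `Φ z = ∫ K z`
  have hΦK : ∀ z : ℂ, Φ z = ∫ ξ, K z ξ ∂μ := by
    intro z
    simp only [hKdef]
    rw [hΦdef, integral_const_mul, rightRegular_toLp_eq hf hfm, MeasureTheory.L2.inner_def]
    congr 1
    refine integral_congr_ae ?_
    filter_upwards [h₃m.coeFn_toLp, (memLp_toQuotFun_mul_right (μ := μ) hf (adelicSingle F E c 2 J hc hfix w₁ (ub z))).coeFn_toLp]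
      with ξ h₁ h₂
    rw [RCLike.inner_apply, h₁, h₂, mul_comm]
  -- continuity of the integrand in `ξ`
  have hKcont : ∀ z, Continuous (K z) := fun z =>
    continuous_const.mul ((Complex.continuous_conj.comp hφ₃C).mul (continuous_toQuotFun (leftInvariant_mul_right hfL _)
      (hfC.comp (continuous_id.mul continuous_const))))
  -- holomorphy of the integrand in `z` on the disc
  have hKdiff : ∀ ξ, DifferentiableOn ℂ (fun z => K z ξ) (ball (0 : ℂ) (Real.sqrt r)) := by
    intro ξ
    obtain ⟨x₀, rfl⟩ := toAutomorphicQuotient_surjective ξ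
    obtain ⟨Φy, hΦy, hΦyf⟩ := ((mem_holCotForms₂_iff F E c J hc hfix w₁ 𝔣 f).1 hf).2.2.2 x₀⁻¹
    -- the slice `z ↦ 1 + z N` as a map into `ℂ^{2×2}` (Pi norm), holomorphic, valued in the cone-open on the disc
    let Of : Fin 2 → Fin 2 → ℂ := (1 : Matrix (Fin 2) (Fin 2) ℂ)
    let Nf : Fin 2 → Fin 2 → ℂ := N
    have hsl : Differentiable ℂ (fun z : ℂ => Of + z • Nf) := (differentiable_id.smul_const Nf).const_add Of
    have hslN : ∀ z : ℂ, Matrix.of (Of + z • Nf) = 1 + z • N := fun _ => rfl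
    have hmaps : Set.MapsTo (fun z : ℂ => Of + z • Nf) (ball (0 : ℂ) (Real.sqrt r))
        {g | IsUnit (Matrix.of g) ∧ Matrix.of g *ᵥ 𝔣.v₀ ∈ negCone (J.map w₁.1.embedding)} := by
      intro z hz
      rw [Set.mem_setOf_eq, hslN, (slice_props 𝔣 hNv hNt hNN z).1]
      exact ⟨isUnit_slice 𝔣 hNv hNt hNN z, (v₀_add_smul_t₀_mem_negCone_iff 𝔣 hvt hvv z).2 ((norm_sq_lt_iff z).2 hz)⟩
    have hcomp := (hΦy.1.comp hsl.differentiableOn hmaps).const_mul (starRingEnd ℂ (f₃ x₀⁻¹))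
    refine hcomp.congr fun z hz => ?_
    have hz' : ‖z‖ ^ 2 < r := (norm_sq_lt_iff z).2 hz
    obtain ⟨-, -, hu't, hu'v⟩ := hub z hz'
    rw [Function.comp_apply, hslN, hKdef, toQuotFun_mk hf₃L x₀,
      toQuotFun_mk (leftInvariant_mul_right hfL (adelicSingle F E c 2 J hc hfix w₁ (ub z))) x₀,
      apply_slice_eq x₀⁻¹ hΦy hΦyf hNv hNt hr (hν z hz').1 (hν z hz').2 hu't hu'v]
    ring
  -- the multiplier `ν_z⁻²` in closed form (stated for the local `ν` to keep rewriting syntactic)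
  have hνν : ∀ z : ℂ, ‖z‖ ^ 2 < r → ((ν z : ℂ))⁻¹ * ((ν z : ℂ))⁻¹ = ((r / (r - ‖z‖ ^ 2) : ℝ) : ℂ) :=
    fun z hz => boostMultiplier_eq hr hz
  -- the local bound
  have hKbound : ∀ z : ℂ, ‖z‖ ^ 2 < r → ∀ ξ, ‖K z ξ‖ ≤ (r / (r - ‖z‖ ^ 2)) * (C₃ * Cf) := by
    intro z hz ξ
    obtain ⟨x₀, rfl⟩ := toAutomorphicQuotient_surjective ξ
    rw [hKdef, hνν z hz, toQuotFun_mk hf₃L x₀,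
      toQuotFun_mk (leftInvariant_mul_right hfL (adelicSingle F E c 2 J hc hfix w₁ (ub z))) x₀, norm_mul, norm_mul,
      Complex.norm_real, Real.norm_of_nonneg (div_pos hr (sub_pos.2 hz)).le, RCLike.norm_conj]
    have h1 : ‖f₃ x₀⁻¹‖ ≤ C₃ := by rw [apply_eq_toQuotFun hf₃L]; exact hC₃ _ (Set.mem_univ _)
    exact mul_le_mul_of_nonneg_left (mul_le_mul h1 (hfb _) (norm_nonneg _) hC₃0) (div_pos hr (sub_pos.2 hz)).le
  have hdiff : DifferentiableOn ℂ Φ (ball (0 : ℂ) (Real.sqrt r)) := by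
    have hint : DifferentiableOn ℂ (fun z => ∫ ξ, K z ξ ∂μ) (ball (0 : ℂ) (Real.sqrt r)) := by
      refine Literature.Analysis.Complex.differentiableOn_integral_of_dominated (fun z _ => (hKcont z).aestronglyMeasurable)
        (Filter.Eventually.of_forall hKdiff) fun z₀ hz₀ => ?_
      have hz₀' : ‖z₀‖ < Real.sqrt r := by rwa [mem_ball, dist_zero_right] at hz₀
      set ρ₁ : ℝ := (‖z₀‖ + Real.sqrt r) / 2 with hρ₁
      have hρ₁lt : ρ₁ < Real.sqrt r := by rw [hρ₁]; linarith
      have hρ₁pos : 0 ≤ ρ₁ := by rw [hρ₁]; positivity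
      have hρ₁sq : ρ₁ ^ 2 < r := (Real.lt_sqrt hρ₁pos).1 hρ₁lt
      refine ⟨ρ₁ - ‖z₀‖, by rw [hρ₁]; linarith, fun z hz => ?_, fun _ => (r / (r - ρ₁ ^ 2)) * (C₃ * Cf), integrable_const _,
        Filter.Eventually.of_forall fun ξ z hz => ?_⟩
      · rw [mem_ball, dist_zero_right]
        rw [mem_ball] at hz
        calc ‖z‖ ≤ ‖z₀‖ + dist z z₀ := by rw [dist_eq_norm]; exact norm_le_norm_add_norm_sub' z z₀
          _ < Real.sqrt r := by linarith
      · have hzn : ‖z‖ ≤ ρ₁ := by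
          rw [mem_ball, dist_eq_norm] at hz
          have := norm_le_norm_add_norm_sub' z z₀
          linarith
        have hz' : ‖z‖ ^ 2 < r := lt_of_le_of_lt (pow_le_pow_left₀ (norm_nonneg z) hzn 2) hρ₁sq
        refine (hKbound z hz' ξ).trans (mul_le_mul_of_nonneg_right ?_ (mul_nonneg hC₃0 hCf0))
        exact div_le_div_of_nonneg_left hr.le (sub_pos.2 hρ₁sq) (sub_le_sub_left (pow_le_pow_left₀ (norm_nonneg z) hzn 2) r)
    exact hint.congr fun z _ => hΦK z
  /- (4) `Φ ≡ 0` on the disc: mean value on circles, where `Φ` is constant by (2) -/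
  have hΦt : ∀ t : ℝ, 0 < t → t ^ 2 < r → Φ t = 0 := by
    intro t ht htr
    have htn : ‖(t : ℂ)‖ ^ 2 < r := by rwa [Complex.norm_real, Real.norm_of_nonneg ht.le]
    have hts : |t| < Real.sqrt r := by rw [abs_of_pos ht]; exact (Real.lt_sqrt ht.le).2 htr
    have hdc : DiffContOnCl ℂ Φ (ball (0 : ℂ) |t|) := by
      refine DifferentiableOn.diffContOnCl (hdiff.mono ?_)
      rw [closure_ball (0 : ℂ) (abs_pos.2 ht.ne').ne']
      exact closedBall_subset_ball hts
    have hmv := hdc.circleAverage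
    rw [Real.circleAverage_const_on_circle (a := Φ t) fun x hx => ?_] at hmv
    · rw [hmv, hΦ0]
    · rw [mem_sphere, dist_zero_right, abs_of_pos ht] at hx
      have ht0 : (t : ℂ) ≠ 0 := Complex.ofReal_ne_zero.2 ht.ne'
      have hw : ‖x / (t : ℂ)‖ = 1 := by rw [norm_div, hx, Complex.norm_real, Real.norm_of_nonneg ht.le, div_self ht.ne']
      rw [← hrot (t : ℂ) htn (x / t) hw, div_mul_cancel₀ _ ht0]
  have hΦz : ∀ z : ℂ, ‖z‖ ^ 2 < r → Φ z = 0 := by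
    intro z hz
    by_cases hz0' : z = 0
    · rw [hz0', hΦ0]
    · have hzn : 0 < ‖z‖ := norm_pos_iff.2 hz0'
      have hw : ‖z / (‖z‖ : ℂ)‖ = 1 := by rw [norm_div, Complex.norm_real, Real.norm_of_nonneg hzn.le, div_self hzn.ne']
      have h1 := hrot (‖z‖ : ℂ) (by rwa [Complex.norm_real, Real.norm_of_nonneg hzn.le]) (z / ‖z‖) hw
      rw [div_mul_cancel₀ _ (Complex.ofReal_ne_zero.2 hzn.ne')] at h1
      rw [h1, hΦt ‖z‖ hzn hz]
  /- (5) the given `u` is a boost times a stabiliser element -/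
  obtain ⟨z, q, hz, hq, huz⟩ := exists_coords_of_archLocal 𝔣 hvt hvv u
  obtain ⟨-, -, hu't, hu'v⟩ := hub z hz
  set κ : archLocal E 2 J w₁ := (ub z)⁻¹ * u with hκ
  have hκv : ((κ : GL (Fin 2) ℂ) : Matrix (Fin 2) (Fin 2) ℂ) *ᵥ 𝔣.v₀ = (q * ν z) • 𝔣.v₀ := by
    rw [hκ, Subgroup.coe_mul, Units.val_mul, ← mulVec_mulVec, huz, mulVec_smul,
      inv_boost_mulVec_slice 𝔣 hr (hν z hz).1 (hν z hz).2 hu't hu'v, smul_smul]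
  have hκt := frame_decomp 𝔣 hvt (((κ : GL (Fin 2) ℂ) : Matrix (Fin 2) (Fin 2) ℂ) *ᵥ 𝔣.t₀)
  have hqν : q * (ν z : ℂ) ≠ 0 := mul_ne_zero hq (Complex.ofReal_ne_zero.2 (hν z hz).1.ne')
  have huk : u = ub z * κ := by rw [hκ, mul_inv_cancel_left]
  rw [huk, rightRegular_adelicSingle_mul hf hfm (ub z) κ hqν hκv hκt, inner_smul_left, ← inner_conj_symm]
  have h1 : ⟪(h₃m.toLp (toQuotFun (adelicGroupData F E c 2 J) f₃)), (adelicGroupData F E c 2 J).rightRegular μ (adelicSingle F E c 2 J hc hfix w₁ (ub z)) (hfm.toLp (toQuotFun (adelicGroupData F E c 2 J) f))⟫_ℂ = 0 := by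
    have h2 := hΦz z hz
    rw [hΦdef] at h2
    exact (mul_eq_zero.1 h2).resolve_left (mul_ne_zero (inv_ne_zero (Complex.ofReal_ne_zero.2 (hν z hz).1.ne'))
      (inv_ne_zero (Complex.ofReal_ne_zero.2 (hν z hz).1.ne')))
  rw [h1, map_zero, mul_zero]

end Summit.HodgeConjecture.HodgeConjecture.Cruxes.HLiu418.E2ArchOrthHol

end
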